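import Summits.BirchSwinnertonDyer.BirchSwinnertonDyer.Theorems.GenusKolyvaginAtTwoPowDvdShaCardAtTwoRTLocalKernelRelaxationIndex
import Summits.BirchSwinnertonDyer.BirchSwinnertonDyer.Theorems.GenusKolyvaginAtTwoPowDvdShaCardAtTwoRTLocalKernelTwoTorsion
import HarnessLib

/-!
# Route `GenusKolyvaginAtTwo`, crux L_T `PowDvdShaCardAtTwoRT` (stmt-BirchSwinnertonDyer-23242), LINE 18/19 stub 3a⁗, step (b):
# DOUBLING A `d_K`-RELAXED CLASS MAKES IT STRICT — `c` relaxed at a quadratic place `w ∣ v` ⟹ `2·c` satisfies the `ℚ_v`-condition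

Seat `bsd-line-gk2-p2` g16 (PROVER seat 2/3, cell `bsd-f1-sign2`), `--supports 23242 --as helper`; a two-line corollary of gk2-p3's
`two_nsmul_eq_zero_of_mem_localKernel` (Matsuno's `W_{v,K}` is killed by `2`, `…RTLocalKernelTwoTorsion`) and the level-`n`
dictionary of `…RTLocalKernelRelaxationIndex`. THEOREMS ONLY. BSD is not proved by any of this; neither is the crux.

WHY (memo `Cruxes/PowDvdShaCardAtTwoRT/Lines/plus-descent-step-b-prop52.md`, Addendum 4, the «`X = 2Z`» engine of the bottom rung).
A Kolyvagin class descended from the Heegner field `K` to `ℚ` is, at a prime `p ∣ d_K`, only RELAXED: it satisfies the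
`K_w`-local condition (`selmerLocalKer E (w.adicCompletion K) n`), not the `ℚ_v`-one; the relaxed-vs-strict quotient embeds in
Matsuno's `W_{v,K} = ker(H¹(ℚ_v, E) → H¹(K_w, E))`, a group killed by `[K_w : ℚ_v] = 2`. Hence DOUBLING a relaxed class gives a
STRICT one (`two_zsmul_mem_selmerLocalKer_of_mem`), and in the ℚ-side reciprocity law for the pair `(2Z, ỹ)` with `ỹ` strict at
`p ∣ d_K` the `d_K`-terms vanish (both classes in the Kummer Lagrangian) — no «`d_K` bit» is left, whatever
`δ = Σ_{p∣d_K} dim E(ℚ_p)[2]` is. The same lemma is the reason the genus budget of the landed frames is spent only on `2`-TORSION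
(`[relaxed : strict]` is a `2`-torsion group of order `≤ #E(ℚ_v)[2]`, gk2-p3 `relIndex_selmerLocalKer_le_natCard_twoTorsion`).

* `two_nsmul_mem_localRestrictionKer_of_mem` — torsor level: `c ∈ ker(H¹(ℚ,E) → H¹(K_w,E))` ⟹ `2·c ∈ ker(H¹(ℚ,E) → H¹(ℚ_v,E))`;
* **`two_zsmul_mem_selmerLocalKer_of_mem`** — level `n`: `c ∈ selmerLocalKer E K_w n` ⟹ `2·c ∈ selmerLocalKer E ℚ_v n`;
* `pow_succ_zsmul_mem_selmerLocalKer_of_mem` — the form used with `X = 2^{s+1}Z`, `s ≥ 0`.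

References: [Matsuno2009] §3 (W_{v,K}), Prop. 3.2; [Kramer1981] §2 Prop. 3; [SerreGaloisCohomology1997] I.§2.4 (Cor. to Prop. 9).
-/

set_option autoImplicit false
-- the Theorems namespace of this sub repeats the summit name by design (D-0017 nested layout)
set_option linter.dupNamespace false

noncomputable section

open scoped Classical

namespace Summit.BirchSwinnertonDyer.BirchSwinnertonDyer.Theorems.GenusExact.PlusDescent

open WeierstrassCurve NumberField IsDedekindDomain Literature.NumberTheory.EllipticCurves
  Literature.Barriers.BirchSwinnertonDyer

variable (E : WeierstrassCurve ℚ) (K : Type) [Field K] [NumberField K]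
  (v : HeightOneSpectrum (𝓞 ℚ)) (w : HeightOneSpectrum (𝓞 K)) [w.asIdeal.LiesOver v.asIdeal]

/-- **Torsor level: a class of `H¹(ℚ, E)` dying in `H¹(K_w, E)`, doubled, dies in `H¹(ℚ_v, E)`** at a quadratic place
`[K_w : ℚ_v] = 2`: its restriction to `ℚ_v` lies in Matsuno's `W_{v,K}`, which `2` kills (`two_nsmul_eq_zero_of_mem_localKernel`).
[cite: Matsuno2009, §3 (p. 451, W_{v,K})] [cite: SerreGaloisCohomology1997, I.§2.4 Cor. to Prop. 9] -/
theorem two_nsmul_mem_localRestrictionKer_of_mem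
    (h2 : letI : Algebra (v.adicCompletion ℚ) (w.adicCompletion K) :=
        (Literature.NumberTheory.EllipticCurves.adicCompletionMap (K := ℚ) K v w).toAlgebra
      Module.finrank (v.adicCompletion ℚ) (w.adicCompletion K) = 2)
    {c : E.galH1} (hc : c ∈ E.localRestrictionKer (w.adicCompletion K)) :
    2 • c ∈ E.localRestrictionKer (v.adicCompletion ℚ) := by
  letI : Algebra (v.adicCompletion ℚ) (w.adicCompletion K) :=
    (Literature.NumberTheory.EllipticCurves.adicCompletionMap (K := ℚ) K v w).toAlgebra
  haveI : IsScalarTower ℚ (v.adicCompletion ℚ) (w.adicCompletion K) :=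
    IsScalarTower.of_algebraMap_eq fun x ↦
      (Literature.NumberTheory.EllipticCurves.adicCompletionMap_coe (K := ℚ) K v w x).symm
  have h : resBaseChange E (v.adicCompletion ℚ) c ∈ Matsuno2009.localKernel E K v w :=
    (mem_localRestrictionKer_iff_resBaseChange_mem E (L := v.adicCompletion ℚ) (E' := w.adicCompletion K) c).mp hc
  have h0 : 2 • resBaseChange E (v.adicCompletion ℚ) c = 0 := two_nsmul_eq_zero_of_mem_localKernel E K v w h2 h
  rw [← map_nsmul] at h0
  exact (mem_ker_resBaseChange_iff E (v.adicCompletion ℚ) (2 • c)).mp h0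

/-- **Level `n`: DOUBLING A `d_K`-RELAXED CLASS MAKES IT STRICT.** At a quadratic place `w ∣ v` (`[K_w : ℚ_v] = 2`), a class
`c ∈ H¹(ℚ, E[n])` satisfying the `K_w`-local Selmer condition has `2·c` satisfying the `ℚ_v`-local one: the two conditions are the
preimages of the torsor-level kernels under `H¹(ℚ, E[n]) → H¹(ℚ, E)` (`mem_selmerLocalKer_iff_torsionH1ToH1_mem`). In the ℚ-side
swap engine: `X = 2Z` pairs trivially with every class Kummer at `p ∣ d_K`. [cite: Matsuno2009, §3 and Prop. 3.2]
[cite: Kramer1981, §2 Prop. 3] -/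
theorem two_zsmul_mem_selmerLocalKer_of_mem
    (h2 : letI : Algebra (v.adicCompletion ℚ) (w.adicCompletion K) :=
        (Literature.NumberTheory.EllipticCurves.adicCompletionMap (K := ℚ) K v w).toAlgebra
      Module.finrank (v.adicCompletion ℚ) (w.adicCompletion K) = 2)
    (n : ℤ) {c : galH1Torsion E n} (hc : c ∈ selmerLocalKer E (w.adicCompletion K) n) :
    (2 : ℤ) • c ∈ selmerLocalKer E (v.adicCompletion ℚ) n := by
  rw [WeierstrassCurve.mem_selmerLocalKer_iff_torsionH1ToH1_mem] at hc ⊢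
  rw [map_zsmul, ofNat_zsmul]
  exact two_nsmul_mem_localRestrictionKer_of_mem E K v w h2 hc

/-- The form used with `X = 2^{s+1}·Z`: every multiple `2^{s+1}·c` (`s ≥ 0`) of a relaxed class is strict. [cite: Matsuno2009, §3] -/
theorem pow_succ_zsmul_mem_selmerLocalKer_of_mem
    (h2 : letI : Algebra (v.adicCompletion ℚ) (w.adicCompletion K) :=
        (Literature.NumberTheory.EllipticCurves.adicCompletionMap (K := ℚ) K v w).toAlgebra
      Module.finrank (v.adicCompletion ℚ) (w.adicCompletion K) = 2)
    (n : ℤ) {c : galH1Torsion E n} (hc : c ∈ selmerLocalKer E (w.adicCompletion K) n) (s : ℕ) :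
    ((2 : ℤ) ^ (s + 1)) • c ∈ selmerLocalKer E (v.adicCompletion ℚ) n := by
  rw [pow_succ, mul_smul]
  exact AddSubgroup.zsmul_mem _ (two_zsmul_mem_selmerLocalKer_of_mem E K v w h2 n hc) _

end Summit.BirchSwinnertonDyer.BirchSwinnertonDyer.Theorems.GenusExact.PlusDescent

end
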